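import Summits.BirchSwinnertonDyer.BirchSwinnertonDyer.Theorems.CMKolyvaginAtInertTwoImageToolkitAtTwo
import Summits.BirchSwinnertonDyer.BirchSwinnertonDyer.Theorems.KolyvaginRankRigidityAtTwoOffHabitatIrredNonSurjTwoConverseNoTwoTorsionOverKOfIrred
import HarnessLib

/-!
# Route `KolyvaginRankRigidityAtTwo`, residual crux R_irr `OffHabitatIrredNonSurjTwoConverse`
# (stmt-BirchSwinnertonDyer-27123, LINE 8 «margin absorbs index»): `E(K̄)[2]` IS A SIMPLE
# `Γ_K`-MODULE OFF THE HABITAT — from `E(ℚ)[2] = 0` alone, for every imaginary quadratic `K`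
# (helper, PROVED, unconditional; width seat `bsd-line-krr2-p2` g9)

The second image input `hS` of the finite-index Čebotarev theorem
(`…OffHabitatIrredChebotarevOneClassFiniteIndex`:
`exists_kolyvaginPrime_gt_two_eigenclass_of_inflationDefect`) — every `Γ_K`-stable subgroup of
`E(K̄)[2]` is `⊥` or `⊤` — is supplied on the habitat by surjectivity mod `2`
(`KolyvaginImageTwo.eq_bot_or_eq_top_two_of_hasSurjectiveModNGaloisRep`: the order-`3` element).
On the frame of R_irr (`E(ℚ)[2] = 0`, i.e. `ρ̄_{E,2}` irreducible with image `C₃` or `S₃`, the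
`2`-adic image of finite index) surjectivity is gone, but simplicity survives for EVERY quadratic
`K`: by the landed stub `stub_noTwoTorsionOverK_of_irred` (p634161) `E(K)[2] = 0`, so by Galois
descent (`fixedPoints_eq_range_map_holds`) no non-zero point of `E(K̄)[2]` is fixed by all of `Γ_K`
(`geomTorsion_two_eq_zero_of_forall_smul_eq`); and a group acting on the Klein four-group with no
common non-zero fixed point contains an element WITHOUT non-zero fixed points
(`exists_fixedPointFree_two`: two distinct "transpositions" of `E[2] ∖ 0` compose to a `3`-cycle),
which is the input of `KolyvaginImageTwo.eq_bot_or_eq_top_two`. Results: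
`simple_two_of_torsionBy_baseChange_eq_bot` (`E(K)[2] = 0 ⟹ hS`) and
`simple_two_of_torsionBy_eq_bot` (`E(ℚ)[2] = 0`, `K` imaginary quadratic `⟹ hS`).

HONEST FRAMING: helper lemmas (`--supports` 27123); nothing here closes R_irr, U1 28083 or the print
item 23091; BSD is NOT proved by any of this.

References: [GrossLMS1991] §9 (proof of Prop. 9.3: "`E_p` is a simple `𝒢`-module"), §2 ((2.2):
`E(K)[p] = 0`); [SilvermanAEC2009] VIII.§1 (proof of Prop. 1.2: Galois descent of points),
Ex. III.3.7 (d); [McCallumLMS1991] §3 (standing hypotheses); [RouseZureickBrown2015].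
-/

set_option autoImplicit false
-- the Theorems namespace of this sub repeats the summit name by design (D-0017 nested layout)
set_option linter.dupNamespace false

noncomputable section

open scoped Classical

namespace Summit.BirchSwinnertonDyer.BirchSwinnertonDyer.Theorems.KolyvaginLowerBoundAtTwo

open WeierstrassCurve Field
open Literature.NumberTheory.GaloisRepresentations Literature.NumberTheory.EllipticCurves
open Summit.BirchSwinnertonDyer.BirchSwinnertonDyer.Theorems.KolyvaginImageTwo

universe u

/-! ### A group acting on the four-group without a common fixed point has a fixed-point-free element -/

section Module

variable {G : Type*} [Group G] {T : Type*} [AddCommGroup T] [DistribMulAction G T]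

/-- **Fixed-point-free elements from the absence of common fixed points on the four-group.** If a
group `G` acts on `T ≅ (ℤ/2)²` and every non-zero `t` is moved by some element of `G`, then some
`z ∈ G` acts without non-zero fixed points. (Either a moving element is already fixed-point-free,
or two elements of `G` act as distinct transpositions of `T ∖ 0 = {a, u, a + u}` and their product is
a `3`-cycle.) [folklore] [cite: GrossLMS1991, §9 (proof of Prop. 9.3)] -/
theorem exists_fixedPointFree_two (h2 : ∀ t : T, t + t = 0) (hcard : Nat.card T = 4)
    (hmove : ∀ t : T, t ≠ 0 → ∃ g : G, g • t ≠ t) :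
    ∃ z : G, ∀ t : T, z • t = t → t = 0 := by
  haveI : Finite T := Nat.finite_of_card_ne_zero (by rw [hcard]; norm_num)
  haveI : Nontrivial T := Finite.one_lt_card_iff_nontrivial.mp (by rw [hcard]; norm_num)
  -- cancellation facts in the four-group
  have hself : ∀ {x y : T}, x + y = x → y = 0 := fun {x y} h ↦ by simpa using h
  have hself' : ∀ {x y : T}, x + y = y → x = 0 := fun {x y} h ↦ by simpa using h
  have haddadd : ∀ x y : T, x + (x + y) = y := fun x y ↦ by rw [← add_assoc, h2, zero_add]
  have hinj : ∀ (g : G) {x y : T}, g • x = g • y → x = y := fun g {x y} h ↦ smul_left_cancel g h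
  have hne0 : ∀ (g : G) {x : T}, x ≠ 0 → g • x ≠ 0 := fun g {x} hx h ↦
    hx ((smul_eq_zero_iff_eq g).mp h)
  obtain ⟨a, ha⟩ := exists_ne (0 : T)
  obtain ⟨g₁, hg₁a⟩ := hmove a ha
  by_cases hfree₁ : ∀ t : T, g₁ • t = t → t = 0
  · exact ⟨g₁, hfree₁⟩
  push Not at hfree₁
  obtain ⟨u, hg₁u, hu⟩ := hfree₁
  have hua : u ≠ a := fun h ↦ hg₁a (by rw [← h]; exact hg₁u)
  -- `g₁` fixes `u` and moves `a`, hence swaps `a` and `a + u`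
  have hg₁a' : g₁ • a = a + u := by
    rcases mem_four h2 hcard ha hu hua (g₁ • a) with h | h | h | h
    · exact absurd h (hne0 g₁ ha)
    · exact absurd h hg₁a
    · exact absurd (hinj g₁ (h.trans hg₁u.symm)) hua.symm
    · exact h
  have hg₁au : g₁ • (a + u) = a := by
    rw [smul_add, hg₁a', hg₁u, add_assoc, h2, add_zero]
  obtain ⟨g₂, hg₂u⟩ := hmove u hu
  by_cases hfree₂ : ∀ t : T, g₂ • t = t → t = 0
  · exact ⟨g₂, hfree₂⟩
  push Not at hfree₂
  obtain ⟨w, hg₂w, hw⟩ := hfree₂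
  have hwu : w ≠ u := fun h ↦ hg₂u (by rw [← h]; exact hg₂w)
  -- `w ∈ {a, a + u}`; in both cases `g₁ g₂` is a `3`-cycle on `{a, u, a + u}`
  refine ⟨g₁ * g₂, fun t ht ↦ ?_⟩
  rw [mul_smul] at ht
  rcases mem_four h2 hcard ha hu hua w with h | h | h | h
  · exact absurd h hw
  · -- `w = a`: `g₂` fixes `a` and swaps `u`, `a + u`
    rw [h] at hg₂w
    have hg₂u' : g₂ • u = a + u := by
      rcases mem_four h2 hcard ha hu hua (g₂ • u) with h' | h' | h' | h'
      · exact absurd h' (hne0 g₂ hu)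
      · exact absurd (hinj g₂ (h'.trans hg₂w.symm)) hua
      · exact absurd h' hg₂u
      · exact h'
    have hg₂au : g₂ • (a + u) = u := by rw [smul_add, hg₂w, hg₂u', haddadd]
    rcases mem_four h2 hcard ha hu hua t with rfl | rfl | rfl | rfl
    · rfl
    · rw [hg₂w, hg₁a'] at ht
      exact absurd (hself ht) hu
    · rw [hg₂u', hg₁au] at ht
      exact absurd ht hua.symm
    · rw [hg₂au, hg₁u] at ht
      exact absurd (hself' ht.symm) ha
  · exact absurd h hwu
  · -- `w = a + u`: `g₂` fixes `a + u` and swaps `a`, `u`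
    rw [h] at hg₂w
    have hg₂u' : g₂ • u = a := by
      rcases mem_four h2 hcard ha hu hua (g₂ • u) with h' | h' | h' | h'
      · exact absurd h' (hne0 g₂ hu)
      · exact h'
      · exact absurd h' hg₂u
      · exact absurd (hself' (hinj g₂ (h'.trans hg₂w.symm)).symm) ha
    have hg₂a : g₂ • a = u := by
      have e : a = (a + u) + u := by rw [add_assoc, h2, add_zero]
      rw [e, smul_add, hg₂w, hg₂u', add_comm (a + u) a, haddadd]
    rcases mem_four h2 hcard ha hu hua t with rfl | rfl | rfl | rfl
    · rfl
    · rw [hg₂a, hg₁u] at ht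
      exact absurd ht hua
    · rw [hg₂u', hg₁a'] at ht
      exact absurd (hself' ht) ha
    · rw [hg₂w, hg₁au] at ht
      exact absurd (hself ht.symm) hu

end Module

/-! ### Galois descent: `E(K)[2] = 0` ⟹ no non-zero `Γ_K`-fixed point of `E(K̄)[2]` -/

section Galois

/-- **No non-zero point of `E(K̄)[2]` is `Γ_K`-fixed when `E(K)[2] = 0`** (a fixed point is
`K`-rational by Galois descent, the tree's `fixedPoints_eq_range_map_holds`, and base change of
points is injective). [cite: SilvermanAEC2009, VIII.§1 (proof of Prop. 1.2)] [cite: GrossLMS1991, §2 ((2.2))] -/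
theorem geomTorsion_two_eq_zero_of_forall_smul_eq (W : WeierstrassCurve ℚ) [W.IsElliptic]
    (K : Type) [Field K] [NumberField K]
    (htor : AddSubgroup.torsionBy (W.baseChange K).toAffine.Point (2 : ℤ) = ⊥)
    {P : geomTorsion (W.baseChange K) ((2 : ℕ) : ℤ)}
    (hP : ∀ σ : absoluteGaloisGroup K, σ • P = P) : P = 0 := by
  by_contra hP0
  have hfix : (P : (W.baseChange K).geomPoints) ∈
      MulAction.fixedPoints (absoluteGaloisGroup K) (W.baseChange K).geomPoints := by
    rw [MulAction.mem_fixedPoints]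
    intro σ
    rw [← AddSubgroup.torsionBy.coe_smul, hP σ]
  rw [fixedPoints_eq_range_map_holds (W.baseChange K)] at hfix
  obtain ⟨Q, hQ⟩ := hfix
  simp only at hQ
  have hinj : Function.Injective
      (Affine.Point.baseChange K (AlgebraicClosure K) :
        ((W.baseChange K).baseChange K).toAffine.Point → (W.baseChange K).geomPoints) :=
    Affine.Point.map_injective _
  have hQ0 : Q ≠ 0 := by
    rintro rfl
    apply hP0
    apply Subtype.ext
    rw [ZeroMemClass.coe_zero, ← hQ]
    exact map_zero _
  have h2Q : (2 : ℤ) • Q = 0 := by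
    apply hinj
    rw [map_zsmul, map_zero, hQ]
    have := (mem_geomTorsion_iff (W.baseChange K) _ (P : (W.baseChange K).geomPoints)).1 P.2
    exact_mod_cast this
  -- `(W.baseChange K).baseChange K = W.baseChange K` definitionally: `Q` is a point of `E(K)[2] = 0`
  have key : ∀ Q' : (W.baseChange K).toAffine.Point, (2 : ℤ) • Q' = 0 → Q' = 0 := fun Q' h ↦ by
    have hm : Q' ∈ AddSubgroup.torsionBy (W.baseChange K).toAffine.Point (2 : ℤ) :=
      (Submodule.mem_torsionBy_iff _ _).mpr h
    rw [htor] at hm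
    exact (AddSubgroup.mem_bot).mp hm
  exact hQ0 (key Q h2Q)

/-- **`E(K̄)[2]` is a simple `Γ_K`-module as soon as `E(K)[2] = 0`** (for `E = W/ℚ` base-changed to a
number field `K`): every `Γ_K`-stable subgroup of `E(K̄)[2]` is `⊥` or `⊤`. No surjectivity of
`ρ̄_{E,2}` is assumed. [cite: GrossLMS1991, §9 (proof of Prop. 9.3)] -/
theorem simple_two_of_torsionBy_baseChange_eq_bot (W : WeierstrassCurve ℚ) [W.IsElliptic]
    (K : Type) [Field K] [NumberField K]
    (htor : AddSubgroup.torsionBy (W.baseChange K).toAffine.Point (2 : ℤ) = ⊥) :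
    ∀ H : AddSubgroup (geomTorsion (W.baseChange K) ((2 : ℕ) : ℤ)),
      (∀ g : absoluteGaloisGroup K, ∀ t ∈ H, g • t ∈ H) → H = ⊥ ∨ H = ⊤ := by
  have h2 : ∀ t : geomTorsion (W.baseChange K) ((2 : ℕ) : ℤ), t + t = 0 := fun t ↦ by
    have := AddSubgroup.torsionBy.nsmul t
    rwa [two_nsmul] at this
  have hmove : ∀ t : geomTorsion (W.baseChange K) ((2 : ℕ) : ℤ), t ≠ 0 →
      ∃ g : absoluteGaloisGroup K, g • t ≠ t := by
    intro t ht
    by_contra! h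
    exact ht (geomTorsion_two_eq_zero_of_forall_smul_eq W K htor h)
  obtain ⟨z, hz⟩ := exists_fixedPointFree_two h2 (natCard_geomTorsion_two W K) hmove
  intro H hH
  exact eq_bot_or_eq_top_two h2 (natCard_geomTorsion_two W K) hz H hH

/-- **The input `hS` of the finite-index Čebotarev theorem on the frame of R_irr 27123**: for
`E = W/ℚ` with `E(ℚ)[2] = 0` (`ρ̄_{E,2}` irreducible — image `C₃` or `S₃`; NO surjectivity, any
`2`-adic index) and every imaginary quadratic `K`, `E(K̄)[2]` is a simple `Γ_K`-module — via the
landed stub `KolyvaginRankRigidity.stub_noTwoTorsionOverK_of_irred` (`E(K)[2] = 0`).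
[cite: GrossLMS1991, §9 (proof of Prop. 9.3), §2 ((2.2))] [cite: SilvermanAEC2009, Ex. III.3.7 (d)] -/
theorem simple_two_of_torsionBy_eq_bot (W : WeierstrassCurve ℚ) [W.IsElliptic]
    (htorQ : AddSubgroup.torsionBy W.toAffine.Point (2 : ℤ) = ⊥)
    (K : Type) [Field K] [NumberField K] (hK : IsImaginaryQuadratic K) :
    ∀ H : AddSubgroup (geomTorsion (W.baseChange K) ((2 : ℕ) : ℤ)),
      (∀ g : absoluteGaloisGroup K, ∀ t ∈ H, g • t ∈ H) → H = ⊥ ∨ H = ⊤ :=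
  simple_two_of_torsionBy_baseChange_eq_bot W K
    (KolyvaginRankRigidity.stub_noTwoTorsionOverK_of_irred W htorQ K hK)

end Galois

end Summit.BirchSwinnertonDyer.BirchSwinnertonDyer.Theorems.KolyvaginLowerBoundAtTwo

end
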